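import Literature.NumberTheory.Automorphic.ArchBigCellTransport
import Literature.NumberTheory.Automorphic.BorelBruhatCellsGK
import HarnessLib

/-!
# Place projections `GL_n(K_∞) → GL_n(ℂ)` and the Bruhat stratification at one archimedean place

Topic `NumberTheory/Automorphic`; namespace `Literature.NumberTheory.Automorphic`. The archimedean
algebra `K_∞ = mixedSpace K = (∏_{w real} ℝ) × (∏_{w complex} ℂ)` is a finite product of copies of `ℝ`
and `ℂ`, indexed by `PlaceIdx K = {w real} ⊕ {w complex}`. For every index `v` we have

* the continuous ring homomorphism `placeEmbC v : K_∞ →+* ℂ` (evaluation at `v`, composed with `ℝ ⊆ ℂ`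
  at a real place) and the idempotent `placeIdem v ∈ K_∞` (`placeEmbC_placeIdem`, `sum_placeIdem`,
  `eq_sum_placeIdem_mul`); an element of `K_∞` is determined by its images (`ext_placeEmbC`) and is a unit
  iff all its images are non-zero (`isUnit_iff_placeEmbC_ne_zero`);
* the continuous homomorphism `placeGL v : GL_n(K_∞) →* GL_n(ℂ)` (`Matrix.GeneralLinearGroup.map`);
* the **Bruhat cells and levels at the place `v`**: `placeCell v σ = (placeGL v)⁻¹(B P_σ U_n)` and
  `placeLevelLT v r = (placeGL v)⁻¹(levelLT r)` (the cells/levels of `GL_n(ℂ)` of `BorelBruhatCellsGK`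
  pulled back), with the inherited properties: the levels are closed and increasing, exhaust `GL_n(K_∞)`,
  every element lies in exactly one cell at `v`, a cell of rank sum `r` lies in `placeLevelLT v (r + 1)` and
  misses `placeLevelLT v r`, and each cell is relatively open in its level
  (`exists_isOpen_inter_placeLevelLT_subset`).

Used to run the Gelfand–Kazhdan small-cell analysis of Shalika (1974), §2–§3, one archimedean place at a
time on `GL_n(K_∞) = ∏_v GL_n(K_v)`. Everything is proved; no named fact is introduced.

## References

* J. A. Shalika, *The multiplicity one theorem for `GL_n`*, Ann. of Math. 100 (1974), §2–§3. [Shalika1974]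
* I. M. Gelfand, D. A. Kazhdan, *Representations of the group GL(n, K) where K is a local field* (1975),
  §§3–4. [GelfandKazhdan1975]
-/

noncomputable section

open NumberField NumberField.InfinitePlace NumberField.mixedEmbedding Set Filter Matrix
open scoped MatrixGroups Topology Classical

namespace Literature.NumberTheory.Automorphic

variable {n : ℕ} {K : Type} [Field K]

local notation "R∞" => mixedSpace K
local notation "Mat" => Matrix (Fin n) (Fin n) (mixedSpace K)
local notation "G∞" => GL (Fin n) (mixedSpace K)

/-! ### 1. The index set of archimedean places and the evaluations `K_∞ → ℂ` -/

variable (K) in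
/-- **The index set of the factors of `K_∞`**: real places and complex places. [folklore] -/
abbrev PlaceIdx : Type := {w : InfinitePlace K // IsReal w} ⊕ {w : InfinitePlace K // IsComplex w}

/-- **Evaluation at a place, with values in `ℂ`**: `x ↦ x_v` (a real place is followed by `ℝ ⊆ ℂ`). [folklore] -/
def placeEmbC : PlaceIdx K → (mixedSpace K →+* ℂ)
  | Sum.inl w => Complex.ofRealHom.comp ((Pi.evalRingHom (fun _ : {w : InfinitePlace K // IsReal w} => ℝ) w).comp
      (RingHom.fst _ _))
  | Sum.inr w => (Pi.evalRingHom (fun _ : {w : InfinitePlace K // IsComplex w} => ℂ) w).comp (RingHom.snd _ _)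

/-- `placeEmbC` at a real place. [folklore] -/
@[simp] theorem placeEmbC_inl (w : {w : InfinitePlace K // IsReal w}) (x : R∞) :
    placeEmbC (Sum.inl w) x = ((x.1 w : ℝ) : ℂ) := rfl

/-- `placeEmbC` at a complex place. [folklore] -/
@[simp] theorem placeEmbC_inr (w : {w : InfinitePlace K // IsComplex w}) (x : R∞) :
    placeEmbC (Sum.inr w) x = x.2 w := rfl

/-- `placeEmbC v` is continuous. [folklore] -/
theorem continuous_placeEmbC (v : PlaceIdx K) : Continuous (placeEmbC v : R∞ → ℂ) := by
  rcases v with w | w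
  · change Continuous fun x : R∞ => ((x.1 w : ℝ) : ℂ)
    exact Complex.continuous_ofReal.comp ((continuous_apply w).comp continuous_fst)
  · change Continuous fun x : R∞ => x.2 w
    exact (continuous_apply w).comp continuous_snd

/-- `placeEmbC v` is real-linear. [folklore] -/
theorem placeEmbC_smul (v : PlaceIdx K) (c : ℝ) (x : R∞) : placeEmbC v (c • x) = (c : ℂ) * placeEmbC v x := by
  rcases v with w | w
  · simp [Complex.ofReal_mul]
  · simp [Complex.real_smul]

/-- **An element of `K_∞` is determined by its components.** [folklore] -/
theorem ext_placeEmbC {x y : R∞} (h : ∀ v : PlaceIdx K, placeEmbC v x = placeEmbC v y) : x = y :=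
  Prod.ext (funext fun w => Complex.ofReal_injective (h (Sum.inl w))) (funext fun w => h (Sum.inr w))

/-- `x = 0` iff all components vanish. [folklore] -/
theorem eq_zero_iff_placeEmbC {x : R∞} : x = 0 ↔ ∀ v : PlaceIdx K, placeEmbC v x = 0 :=
  ⟨fun h v => by rw [h, map_zero], fun h => ext_placeEmbC fun v => by rw [h v, map_zero]⟩

/-- **Units of `K_∞`**: `x` is a unit iff all its components are non-zero. [folklore] -/
theorem isUnit_iff_placeEmbC_ne_zero {x : R∞} : IsUnit x ↔ ∀ v : PlaceIdx K, placeEmbC v x ≠ 0 := by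
  rw [Prod.isUnit_iff, Pi.isUnit_iff, Pi.isUnit_iff]
  constructor
  · rintro ⟨h1, h2⟩ (w | w)
    · rw [placeEmbC_inl]; exact_mod_cast (h1 w).ne_zero
    · rw [placeEmbC_inr]; exact (h2 w).ne_zero
  · intro h
    exact ⟨fun w => isUnit_iff_ne_zero.2 (by have := h (Sum.inl w); rw [placeEmbC_inl] at this; exact_mod_cast this),
      fun w => isUnit_iff_ne_zero.2 (by have := h (Sum.inr w); rwa [placeEmbC_inr] at this)⟩

/-- **The idempotent of a place**: `1_v ∈ K_∞`. [folklore] -/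
def placeIdem : PlaceIdx K → mixedSpace K
  | Sum.inl w => (Pi.single w 1, 0)
  | Sum.inr w => (0, Pi.single w 1)

/-- Components of the idempotents: `(1_{v'})_v = [v = v']`. [folklore] -/
theorem placeEmbC_placeIdem (v v' : PlaceIdx K) : placeEmbC v (placeIdem v' : R∞) = if v = v' then 1 else 0 := by
  rcases v with w | w <;> rcases v' with w' | w'
  · show (((Pi.single w' (1 : ℝ) : {w : InfinitePlace K // IsReal w} → ℝ) w : ℝ) : ℂ) = _
    by_cases h : w = w'
    · subst h; simp
    · rw [Pi.single_eq_of_ne h, if_neg (fun h' => h (Sum.inl_injective h'))]; simp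
  · show (((0 : {w : InfinitePlace K // IsReal w} → ℝ) w : ℝ) : ℂ) = _
    simp
  · show ((0 : {w : InfinitePlace K // IsComplex w} → ℂ) w) = _
    simp
  · show ((Pi.single w' (1 : ℂ) : {w : InfinitePlace K // IsComplex w} → ℂ) w) = _
    by_cases h : w = w'
    · subst h; simp
    · rw [Pi.single_eq_of_ne h, if_neg (fun h' => h (Sum.inr_injective h'))]

/-- `1_v` is idempotent. [folklore] -/
theorem placeIdem_mul_self (v : PlaceIdx K) : (placeIdem v : R∞) * placeIdem v = placeIdem v :=
  ext_placeEmbC fun v' => by rw [map_mul, placeEmbC_placeIdem]; split_ifs <;> simp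

/-- Distinct idempotents are orthogonal. [folklore] -/
theorem placeIdem_mul_of_ne {v v' : PlaceIdx K} (h : v ≠ v') : (placeIdem v : R∞) * placeIdem v' = 0 :=
  ext_placeEmbC fun u => by
    rw [map_mul, placeEmbC_placeIdem, placeEmbC_placeIdem, map_zero]
    by_cases h1 : u = v
    · subst h1; rw [if_pos rfl, if_neg h, mul_zero]
    · rw [if_neg h1, zero_mul]

/-- `Σ_v 1_v = 1`. [folklore] -/
theorem sum_placeIdem [NumberField K] : ∑ v : PlaceIdx K, (placeIdem v : R∞) = 1 :=
  ext_placeEmbC fun u => by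
    rw [map_sum, map_one, Finset.sum_eq_single u]
    · rw [placeEmbC_placeIdem, if_pos rfl]
    · intro v _ hv; rw [placeEmbC_placeIdem, if_neg (Ne.symm hv)]
    · exact fun h => absurd (Finset.mem_univ u) h

/-- The `v`-component of `1_v x` is that of `x`; the others vanish. [folklore] -/
theorem placeEmbC_placeIdem_mul (v v' : PlaceIdx K) (x : R∞) :
    placeEmbC v ((placeIdem v' : R∞) * x) = if v = v' then placeEmbC v x else 0 := by
  rw [map_mul, placeEmbC_placeIdem]; split_ifs <;> simp

/-- **Decomposition along the places**: `x = Σ_v 1_v x`. [folklore] -/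
theorem eq_sum_placeIdem_mul [NumberField K] (x : R∞) : x = ∑ v : PlaceIdx K, (placeIdem v : R∞) * x := by
  rw [← Finset.sum_mul, sum_placeIdem, one_mul]

/-- `1_v x = 0` iff `x_v = 0`. [folklore] -/
theorem placeIdem_mul_eq_zero_iff (v : PlaceIdx K) (x : R∞) : (placeIdem v : R∞) * x = 0 ↔ placeEmbC v x = 0 := by
  rw [eq_zero_iff_placeEmbC]
  constructor
  · intro h; have := h v; rwa [placeEmbC_placeIdem_mul, if_pos rfl] at this
  · intro h u; rw [placeEmbC_placeIdem_mul]; split_ifs with hu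
    · subst hu; exact h
    · rfl

/-! ### 2. The projections `GL_n(K_∞) → GL_n(ℂ)` -/

/-- **The place projection on `GL_n`**: `placeGL v = GL_n(placeEmbC v)`. [folklore] -/
def placeGL (v : PlaceIdx K) : GL (Fin n) (mixedSpace K) →* GL (Fin n) ℂ :=
  Matrix.GeneralLinearGroup.map (placeEmbC v)

/-- The matrix of `placeGL v g` is the entrywise image. [folklore] -/
theorem coe_placeGL (v : PlaceIdx K) (g : G∞) :
    ((placeGL v g : GL (Fin n) ℂ) : Matrix (Fin n) (Fin n) ℂ) = (g : Mat).map (placeEmbC v) := rfl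

/-- Entries of `placeGL v g`. [folklore] -/
theorem placeGL_apply (v : PlaceIdx K) (g : G∞) (i j : Fin n) :
    ((placeGL v g : GL (Fin n) ℂ) : Matrix (Fin n) (Fin n) ℂ) i j = placeEmbC v ((g : Mat) i j) := rfl

/-- `placeGL v` is continuous. [folklore] -/
theorem continuous_placeGL (v : PlaceIdx K) : Continuous (placeGL (n := n) v : G∞ → GL (Fin n) ℂ) := by
  refine Continuous.units_map _ ?_
  change Continuous fun M : Mat => M.map (placeEmbC v)
  exact continuous_id.matrix_map (continuous_placeEmbC v)

/-! ### 3. Bruhat cells and levels at one place -/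

/-- **The Bruhat cell of `σ` at the place `v`**: `{g : g_v ∈ B P_σ U_n}`. [folklore] -/
def placeCell (v : PlaceIdx K) (σ : Equiv.Perm (Fin n)) : Set G∞ := placeGL v ⁻¹' bruhatCell (K := ℂ) σ

/-- **The level `< r` at the place `v`**: `{g : g_v ∈ ⋃_{rankSum τ < r} B P_τ U_n}`. [folklore] -/
def placeLevelLT (v : PlaceIdx K) (r : ℕ) : Set G∞ := placeGL v ⁻¹' levelLT (K := ℂ) r

/-- Membership in a place cell. [folklore] -/
theorem mem_placeCell_iff (v : PlaceIdx K) (σ : Equiv.Perm (Fin n)) (g : G∞) :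
    g ∈ placeCell v σ ↔ placeGL v g ∈ bruhatCell (K := ℂ) σ := Iff.rfl

/-- Membership in a place level. [folklore] -/
theorem mem_placeLevelLT_iff (v : PlaceIdx K) (r : ℕ) (g : G∞) :
    g ∈ placeLevelLT v r ↔ ∃ τ : Equiv.Perm (Fin n), rankSum (_root_.id : Fin n → Fin n) τ < r ∧ g ∈ placeCell v τ := by
  rw [placeLevelLT, mem_preimage, mem_levelLT_iff]; rfl

/-- The levels are closed. [folklore] -/
theorem isClosed_placeLevelLT (v : PlaceIdx K) (r : ℕ) : IsClosed (placeLevelLT (n := n) v r) :=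
  (isClosed_levelLT r).preimage (continuous_placeGL v)

/-- The levels increase. [folklore] -/
theorem placeLevelLT_mono (v : PlaceIdx K) {r r' : ℕ} (h : r ≤ r') : placeLevelLT (n := n) v r ⊆ placeLevelLT v r' :=
  preimage_mono (levelLT_mono h)

/-- `placeLevelLT v 0 = ∅`. [folklore] -/
@[simp] theorem placeLevelLT_zero (v : PlaceIdx K) : placeLevelLT (n := n) v 0 = ∅ := by
  simp [placeLevelLT]

/-- The levels exhaust `GL_n(K_∞)`. [folklore] -/
theorem placeLevelLT_eq_univ (v : PlaceIdx K) {r : ℕ} (hr : ∀ τ : Equiv.Perm (Fin n), rankSum (_root_.id : Fin n → Fin n) τ < r) :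
    placeLevelLT (n := n) v r = univ := by
  rw [placeLevelLT, levelLT_eq_univ hr, preimage_univ]

/-- Every element lies in some cell at `v`. [folklore] -/
theorem exists_mem_placeCell (v : PlaceIdx K) (g : G∞) : ∃ σ : Equiv.Perm (Fin n), g ∈ placeCell v σ :=
  exists_mem_bruhatCell (placeGL v g)

/-- Distinct cells at `v` are disjoint. [folklore] -/
theorem disjoint_placeCell (v : PlaceIdx K) {σ τ : Equiv.Perm (Fin n)} (h : σ ≠ τ) :
    Disjoint (placeCell (n := n) v σ) (placeCell v τ) :=
  (disjoint_bruhatCell h).preimage _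

/-- A cell lies in the next level. [folklore] -/
theorem placeCell_subset_placeLevelLT_succ (v : PlaceIdx K) (σ : Equiv.Perm (Fin n)) :
    placeCell (n := n) v σ ⊆ placeLevelLT v (rankSum (_root_.id : Fin n → Fin n) σ + 1) :=
  preimage_mono (bruhatCell_subset_levelLT_succ σ)

/-- A cell misses its own level. [folklore] -/
theorem disjoint_placeCell_placeLevelLT (v : PlaceIdx K) (σ : Equiv.Perm (Fin n)) :
    Disjoint (placeCell (n := n) v σ) (placeLevelLT v (rankSum (_root_.id : Fin n → Fin n) σ)) :=
  (disjoint_bruhatCell_levelLT σ).preimage _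

/-- **Each cell is relatively open in its level**: near a point of `placeCell v σ`, the only points of
`placeLevelLT v (rankSum σ + 1)` are points of `placeCell v σ`. [folklore] -/
theorem exists_isOpen_inter_placeLevelLT_subset (v : PlaceIdx K) (σ : Equiv.Perm (Fin n)) {g : G∞}
    (hg : g ∈ placeCell v σ) :
    ∃ N : Set G∞, IsOpen N ∧ g ∈ N ∧ N ∩ placeLevelLT v (rankSum (_root_.id : Fin n → Fin n) σ + 1) ⊆ placeCell v σ := by
  obtain ⟨N, hN, hgN, hsub⟩ := exists_isOpen_inter_levelLT_subset (K := ℂ) σ ((mem_placeCell_iff v σ g).1 hg)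
  exact ⟨placeGL v ⁻¹' N, hN.preimage (continuous_placeGL v), hgN, fun x hx => hsub ⟨hx.1, hx.2⟩⟩

/-- The complement of a level is an open neighbourhood filter basis element: `(placeLevelLT v r)ᶜ` is open.
[folklore] -/
theorem isOpen_compl_placeLevelLT (v : PlaceIdx K) (r : ℕ) : IsOpen (placeLevelLT (n := n) v r)ᶜ :=
  (isClosed_placeLevelLT v r).isOpen_compl

end Literature.NumberTheory.Automorphic
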